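import Literature.MathematicalPhysics.QuantumLattice.HubbardCouplingWeights
import Literature.MathematicalPhysics.QuantumLattice.FermionRelabelling
import HarnessLib

/-!
# Transport of the general-coupling Hubbard polymer weights: locality and covariance under
arbitrary injective site maps

Ueltschi (1999), §2.3: "the weight `ρ(𝒜)` of a polymer only involves the sites of `𝒜`" and
"periodic weights". For the general-coupling layer of `HubbardCouplingWeights.lean`
(`couplingWeight β U μ c K`, `couplingActivity D β U μ c`) this file PROVES the two structural
facts behind every identification of polymer weights computed in DIFFERENT volumes (a torus of
side `L`, a torus of side `L'`, a box of `ℤ²`):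

* **locality / congruence**: `couplingWeight_congr` (the weight of `K` only sees `c` on `K`),
  `couplingActivity_congr`, `couplingActivity_congr_of_not_subset` (changing the coupling of one
  bond `b₀` does not change the activity of a polymer not containing both sites of `b₀`),
  `couplingActivity_empty`;
* **covariance under site bijections** `f : Λ ≃ Λ'` that need NOT be monotone for the
  Jordan–Wigner orders (`relabel` of `FermionRelabelling.lean`): `Zc_comp_bondEquiv_symm`
  (`Zc_{Λ'}(c ∘ f⁻¹) = Zc_Λ(c)`), `gibbsRatio_comp_bondEquiv_symm`,
  `couplingWeight_comp_bondEquiv_symm`, `couplingActivity_comp_bondEquiv_symm`;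
* **covariance under injective site maps** `φ : Λ ↪ Λ'` (not necessarily monotone) with the
  couplings extended by zero: `gibbsRatio_extend_of_injective` (factor `φ` as a bijection onto its
  range followed by the ORDER embedding of the range, and combine the previous item with the
  tree's `gibbsRatio_extend`), `couplingWeight_map_inj`, and **`couplingActivity_map_inj`**: if
  `φ` carries the active bonds `D` into `D'` and every bond of `D'` with both sites in `φ(Λ)`
  comes from `D`, and `c' ∘ φ = c` on `D`, then `couplingActivity D' c' (φ A) = couplingActivity D c A`.

## References

* D. Ueltschi, J. Stat. Phys. 95 (1999) 693, §2.3 (locality and periodicity of the weights). [Ueltschi1999]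
* O. Bratteli, D. W. Robinson, *Operator Algebras and QSM II*, §5.2.2 (covariance of the CAR
  algebra under one-particle unitaries). [BratteliRobinsonII1997]
-/

noncomputable section

namespace Literature.MathematicalPhysics.QuantumLattice

open Matrix Finset HubbardWave0 Literature.Analysis.Complex.FiniteDifference Literature.Probability.LatticeModels
open scoped BigOperators

/-! ### Locality: weights and activities only see the couplings on their bonds -/

section Congr

variable {Λ : Type*} [LinearOrder Λ] [Fintype Λ] {β U μ : ℂ}

omit [Fintype Λ] in
/-- Restrictions to `K` of couplings agreeing on `K` agree. [folklore] -/
theorem couplingRestrict_congr {c c' : Bond Λ → ℂ} {K : Finset (Bond Λ)} (h : ∀ b ∈ K, c b = c' b) :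
    couplingRestrict c K = couplingRestrict c' K := by
  funext b
  rw [couplingRestrict_apply, couplingRestrict_apply]
  by_cases hb : b ∈ K
  · rw [if_pos hb, if_pos hb, h b hb]
  · rw [if_neg hb, if_neg hb]

/-- **The weight of `K` only sees the couplings on `K`.** [cite: Ueltschi1999, §2.3 (ρ(𝒜) only involves 𝒜)] -/
theorem couplingWeight_congr {c c' : Bond Λ → ℂ} {K : Finset (Bond Λ)} (h : ∀ b ∈ K, c b = c' b) :
    couplingWeight β U μ c K = couplingWeight β U μ c' K := by
  rw [couplingWeight_eq_sum, couplingWeight_eq_sum]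
  refine Finset.sum_congr rfl fun K' hK' => ?_
  rw [couplingRestrict_congr fun b hb => h b (Finset.mem_powerset.1 hK' hb)]

/-- The activity of `A` only sees the couplings on the connected bond sets supported on `A`.
[cite: Ueltschi1999, §2.3] -/
theorem couplingActivity_congr {D : Finset (Bond Λ)} {c c' : Bond Λ → ℂ} {A : Finset Λ}
    (h : ∀ X ⊆ D, cellSupp Bond.verts X = A → ∀ b ∈ X, c b = c' b) :
    couplingActivity D β U μ c A = couplingActivity D β U μ c' A := by
  rw [couplingActivity_apply, couplingActivity_apply]
  refine Finset.sum_congr rfl fun X hX => ?_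
  obtain ⟨hXD, hXA⟩ := Finset.mem_filter.1 hX
  exact couplingWeight_congr (h X (mem_connectedCellSets.1 hXD).1 hXA)

/-- **Changing the coupling of one bond `b₀` does not change the activity of a polymer that does
not contain both sites of `b₀`.** [cite: Ueltschi1999, §2.3] -/
theorem couplingActivity_congr_of_not_subset {D : Finset (Bond Λ)} {c c' : Bond Λ → ℂ} {b₀ : Bond Λ}
    (h : ∀ b, b ≠ b₀ → c b = c' b) {A : Finset Λ} (hA : ¬ (b₀.1 ∈ A ∧ b₀.2.1 ∈ A)) :
    couplingActivity D β U μ c A = couplingActivity D β U μ c' A := by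
  refine couplingActivity_congr fun X _ hXA b hb => h b fun hbb₀ => hA ?_
  subst hbb₀
  rw [← hXA]
  exact endpoints_mem_cellSupp hb

/-- The empty polymer has zero activity (connected bond sets are nonempty and so are their
supports). [folklore] -/
theorem couplingActivity_empty (D : Finset (Bond Λ)) (c : Bond Λ → ℂ) :
    couplingActivity D β U μ c (∅ : Finset Λ) = 0 := by
  refine couplingActivity_eq_zero c fun X _ hX hXA => ?_
  exact Finset.nonempty_iff_ne_empty.1 (cellSupp_nonempty verts_nonempty hX.1) hXA

end Congr

/-! ### Covariance under orbital relabellings by arbitrary site bijections -/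

section BondEquiv

variable {Λ Λ' : Type*}

/-- The bijection of bonds induced by a site bijection: `(x, y, σ) ↦ (f x, f y, σ)`. [folklore] -/
def bondEquiv (f : Λ ≃ Λ') : Bond Λ ≃ Bond Λ' := Equiv.prodCongr f (Equiv.prodCongr f (Equiv.refl (Fin 2)))

/-- `bondEquiv` unfolded. [folklore] -/
@[simp] theorem bondEquiv_apply (f : Λ ≃ Λ') (b : Bond Λ) : bondEquiv f b = (f b.1, f b.2.1, b.2.2) := rfl

/-- The sites of the image bond. [folklore] -/
theorem verts_bondEquiv [DecidableEq Λ] [DecidableEq Λ'] (f : Λ ≃ Λ') (b : Bond Λ) :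
    Bond.verts (bondEquiv f b) = (Bond.verts b).map f.toEmbedding := by
  simp [Bond.verts, Finset.map_insert]

/-- The embedding of bonds induced by an injective site map: `(x, y, σ) ↦ (φ x, φ y, σ)`. [folklore] -/
def bondMapInj (φ : Λ ↪ Λ') : Bond Λ ↪ Bond Λ' :=
  ⟨fun b => (φ b.1, φ b.2.1, b.2.2), by
    rintro ⟨x, y, σ⟩ ⟨x', y', σ'⟩ h
    simp only [Prod.mk.injEq] at h
    obtain ⟨h1, h2, h3⟩ := h
    rw [φ.injective h1, φ.injective h2, h3]⟩

/-- `bondMapInj` unfolded. [folklore] -/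
@[simp] theorem bondMapInj_apply (φ : Λ ↪ Λ') (b : Bond Λ) : bondMapInj φ b = (φ b.1, φ b.2.1, b.2.2) := rfl

/-- The sites of the image bond. [folklore] -/
theorem verts_bondMapInj [DecidableEq Λ] [DecidableEq Λ'] (φ : Λ ↪ Λ') (b : Bond Λ) :
    Bond.verts (bondMapInj φ b) = (Bond.verts b).map φ := by
  simp [Bond.verts, Finset.map_insert]

/-- The range of `φ` as a finite set of sites of `Λ'`. [folklore] -/
abbrev rangeSites [Fintype Λ] (φ : Λ ↪ Λ') : Finset Λ' := (Finset.univ : Finset Λ).map φ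

/-- The bijection of `Λ` onto the range of `φ` (a sub-volume of `Λ'`; for the order of `Λ'` this
bijection is in general NOT monotone). [folklore] -/
def rangeEquiv [Fintype Λ] (φ : Λ ↪ Λ') : Λ ≃ ↥(rangeSites φ) :=
  Equiv.ofBijective (fun x => ⟨φ x, Finset.mem_map_of_mem φ (Finset.mem_univ x)⟩)
    ⟨fun x y h => φ.injective (by simpa using congrArg Subtype.val h), fun ⟨y, hy⟩ => by
      obtain ⟨x, -, rfl⟩ := Finset.mem_map.1 hy
      exact ⟨x, rfl⟩⟩

/-- `rangeEquiv` unfolded. [folklore] -/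
@[simp] theorem coe_rangeEquiv_apply [Fintype Λ] (φ : Λ ↪ Λ') (x : Λ) : ((rangeEquiv φ x : ↥(rangeSites φ)) : Λ') = φ x := rfl

/-- The order embedding of the range into `Λ'`. [folklore] -/
def rangeOrderEmb [Fintype Λ] [LinearOrder Λ'] (φ : Λ ↪ Λ') : ↥(rangeSites φ) ↪o Λ' := OrderEmbedding.subtype _

/-- `φ` factors as the bijection onto its range followed by the order embedding of the range.
[folklore] -/
theorem rangeOrderEmb_rangeEquiv [Fintype Λ] [LinearOrder Λ'] (φ : Λ ↪ Λ') (x : Λ) : rangeOrderEmb φ (rangeEquiv φ x) = φ x := rfl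

/-- Extension by zero along an injective map precomposed with a bijection:
`extend (g ∘ e) c 0 = extend g (c ∘ e⁻¹) 0`. [folklore] -/
theorem extend_comp_equiv {X Y Z : Type*} (e : X ≃ Y) {g : Y → Z} (hg : Function.Injective g) (c : X → ℂ) :
    Function.extend (g ∘ e) c 0 = Function.extend g (c ∘ e.symm) 0 := by
  funext z
  by_cases h : ∃ y, g y = z
  · obtain ⟨y, rfl⟩ := h
    rw [hg.extend_apply, Function.comp_apply, show g y = (g ∘ e) (e.symm y) by simp,
      (hg.comp e.injective).extend_apply]
  · have h' : ¬ ∃ x, (g ∘ e) x = z := fun ⟨x, hx⟩ => h ⟨e x, hx⟩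
    rw [Function.extend_apply' _ _ _ h', Function.extend_apply' _ _ _ h]

end BondEquiv

section Relabel

variable {Λ Λ' : Type*} [LinearOrder Λ] [Fintype Λ] [LinearOrder Λ'] [Fintype Λ'] (f : Λ ≃ Λ')

/-- Relabelling a bond operator: `Γ T_b Γ⁻¹ = T_{f b}`. [cite: BratteliRobinsonII1997, §5.2.2] -/
theorem relabel_bondOp (b : Bond Λ) : relabel (Orb.mapEquiv f) (bondOp b) = bondOp (bondEquiv f b) := by
  rw [bondOp, map_mul, relabel_creation, relabel_annihilation, Orb.mapEquiv_orb, Orb.mapEquiv_orb, bondOp, bondEquiv_apply]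

/-- Relabelling the hopping operator relabels the couplings: `Γ (Σ_b c_b T_b) Γ⁻¹ = Σ_{b'} c_{f⁻¹b'} T_{b'}`.
[cite: BratteliRobinsonII1997, §5.2.2] -/
theorem relabel_hopSum (c : Bond Λ → ℂ) :
    relabel (Orb.mapEquiv f) (hopSum c) = hopSum (c ∘ (bondEquiv f).symm) := by
  rw [hopSum, map_sum, hopSum]
  simp_rw [map_smul, relabel_bondOp]
  exact Fintype.sum_equiv (bondEquiv f) _ _ fun b => by simp only [Function.comp_apply, Equiv.symm_apply_apply]

/-- Relabelling an on-site term. [cite: BratteliRobinsonII1997, §5.2.2] -/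
theorem relabel_onSiteOp (U μ : ℂ) (x : Λ) : relabel (Orb.mapEquiv f) (onSiteOp U μ x) = onSiteOp U μ (f x) := by
  simp only [onSiteOp, map_sub, map_smul, map_mul, map_add, relabel_mapEquiv_numberOp]

/-- Relabelling the total on-site operator of the volume gives that of the new volume. [cite: BratteliRobinsonII1997, §5.2.2] -/
theorem relabel_onSiteSum_univ (U μ : ℂ) :
    relabel (Orb.mapEquiv f) (onSiteSum U μ (Finset.univ : Finset Λ)) = onSiteSum U μ (Finset.univ : Finset Λ') := by
  rw [onSiteSum, map_sum, onSiteSum]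
  simp_rw [relabel_onSiteOp]
  exact f.sum_comp fun x => onSiteOp U μ x

/-- **The generalised Gibbs factor is invariant under relabelling**: `Zc_{Λ'}(c ∘ f⁻¹) = Zc_Λ(c)` for
every site bijection `f : Λ ≃ Λ'` (monotone or not). [cite: Ueltschi1999, §2.3 (periodic weights)] -/
theorem Zc_comp_bondEquiv_symm (β U μ : ℂ) (c : Bond Λ → ℂ) :
    Zc (Λ := Λ') β U μ (c ∘ (bondEquiv f).symm) = Zc β U μ c := by
  rw [Zc, Zc, ← trace_relabel (Orb.mapEquiv f), relabel_exp, map_add, map_neg, map_smul, relabel_onSiteSum_univ,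
    relabel_hopSum]

/-- The normalised Gibbs factor is invariant under relabelling. [cite: Ueltschi1999, §2.3] -/
theorem gibbsRatio_comp_bondEquiv_symm (β U μ : ℂ) (c : Bond Λ → ℂ) :
    gibbsRatio (Λ := Λ') β U μ (c ∘ (bondEquiv f).symm) = gibbsRatio β U μ c := by
  have h0 : ((0 : Bond Λ → ℂ) ∘ (bondEquiv f).symm) = (0 : Bond Λ' → ℂ) := rfl
  rw [gibbsRatio, gibbsRatio, Zc_comp_bondEquiv_symm, ← h0, Zc_comp_bondEquiv_symm]

omit [Fintype Λ] [Fintype Λ'] in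
/-- Restriction commutes with relabelling. [folklore] -/
theorem couplingRestrict_comp_bondEquiv_symm (c : Bond Λ → ℂ) (K : Finset (Bond Λ)) :
    couplingRestrict (c ∘ (bondEquiv f).symm) (K.map (bondEquiv f).toEmbedding) = couplingRestrict c K ∘ (bondEquiv f).symm := by
  funext b'
  simp only [couplingRestrict_apply, Function.comp_apply, Finset.mem_map_equiv]

/-- **The bond weights are invariant under relabelling.** [cite: Ueltschi1999, §2.3] -/
theorem couplingWeight_comp_bondEquiv_symm (β U μ : ℂ) (c : Bond Λ → ℂ) (K : Finset (Bond Λ)) :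
    couplingWeight (Λ := Λ') β U μ (c ∘ (bondEquiv f).symm) (K.map (bondEquiv f).toEmbedding) = couplingWeight β U μ c K := by
  rw [couplingWeight_eq_sum, couplingWeight_eq_sum]
  symm
  refine Finset.sum_bij (fun K' _ => K'.map (bondEquiv f).toEmbedding) ?_ ?_ ?_ ?_
  · intro K' hK'
    exact Finset.mem_powerset.2 (Finset.map_subset_map.2 (Finset.mem_powerset.1 hK'))
  · intro K₁ _ K₂ _ h
    exact Finset.map_injective _ h
  · intro K'' hK''
    obtain ⟨u, hu, rfl⟩ := Finset.subset_map_iff.1 (Finset.mem_powerset.1 hK'')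
    exact ⟨u, Finset.mem_powerset.2 hu, rfl⟩
  · intro K' _
    rw [couplingRestrict_comp_bondEquiv_symm, gibbsRatio_comp_bondEquiv_symm, ← Finset.map_sdiff, Finset.card_map]

/-- **The site activities are invariant under relabelling.** [cite: Ueltschi1999, §2.3 (periodic weights)] -/
theorem couplingActivity_comp_bondEquiv_symm (β U μ : ℂ) (D : Finset (Bond Λ)) (c : Bond Λ → ℂ) (A : Finset Λ) :
    couplingActivity (D.map (bondEquiv f).toEmbedding) β U μ (c ∘ (bondEquiv f).symm) (A.map f.toEmbedding) =
      couplingActivity D β U μ c A := by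
  refine pushforwardActivity_connectedCellSets_map (verts := (Bond.verts : Bond Λ → Finset Λ))
    (verts' := (Bond.verts : Bond Λ' → Finset Λ')) (f := (bondEquiv f).toEmbedding) (φ := f.toEmbedding)
    (fun b => verts_bondEquiv f b) A subset_rfl (fun X' hX' _ _ => ?_) (fun X _ => couplingWeight_comp_bondEquiv_symm f β U μ c X)
  obtain ⟨X, hX, rfl⟩ := Finset.subset_map_iff.1 hX'
  exact ⟨X, hX, rfl⟩

end Relabel

/-! ### Covariance under injective site maps with the couplings extended by zero -/

section Injective

variable {Λ Λ' : Type*} [LinearOrder Λ] [Fintype Λ] [LinearOrder Λ'] [Fintype Λ'] (φ : Λ ↪ Λ')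

omit [LinearOrder Λ] [Fintype Λ'] in
/-- The induced factorisation of the bond maps. [folklore] -/
theorem bondMap_rangeOrderEmb_bondEquiv (b : Bond Λ) :
    bondMap (rangeOrderEmb φ) (bondEquiv (rangeEquiv φ) b) = bondMapInj φ b := rfl

variable {β U μ : ℂ}

/-- **Covariance of the normalised Gibbs factor under injective site maps** (monotone or not),
the couplings being extended by zero: `g_{Λ'}(φ_* c) = g_Λ(c)` (`z₀ ≠ 0`). Factor `φ` as the
bijection onto its range followed by the order embedding of the range.
[cite: Ueltschi1999, §2.3 (ρ(𝒜) only involves the sites of 𝒜)] -/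
theorem gibbsRatio_extend_of_injective (hz : atomicPartitionFn β U μ ≠ 0) (c : Bond Λ → ℂ) :
    gibbsRatio (Λ := Λ') β U μ (Function.extend (bondMapInj φ) c 0) = gibbsRatio β U μ c := by
  have hfac : (bondMapInj φ : Bond Λ → Bond Λ') = bondMap (rangeOrderEmb φ) ∘ bondEquiv (rangeEquiv φ) := by
    funext b; rfl
  rw [hfac, extend_comp_equiv (bondEquiv (rangeEquiv φ)) (bondMap_injective (rangeOrderEmb φ)) c,
    gibbsRatio_extend (rangeOrderEmb φ) hz, gibbsRatio_comp_bondEquiv_symm]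

omit [Fintype Λ'] in
/-- Restriction along an injective site map is extension by zero of the restriction. [folklore] -/
theorem couplingRestrict_map_inj {c : Bond Λ → ℂ} {c' : Bond Λ' → ℂ} {K : Finset (Bond Λ)}
    (hc : ∀ b ∈ K, c' (bondMapInj φ b) = c b) :
    couplingRestrict c' (K.map (bondMapInj φ)) = Function.extend (bondMapInj φ) (couplingRestrict c K) 0 := by
  funext b'
  by_cases hb' : ∃ b, bondMapInj φ b = b'
  · obtain ⟨b, rfl⟩ := hb'
    rw [(bondMapInj φ).injective.extend_apply, couplingRestrict_apply, couplingRestrict_apply]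
    by_cases hb : b ∈ K
    · rw [if_pos ((Finset.mem_map' (bondMapInj φ)).2 hb), if_pos hb, hc b hb]
    · rw [if_neg (fun h => hb ((Finset.mem_map' (bondMapInj φ)).1 h)), if_neg hb]
  · rw [Function.extend_apply' _ _ _ hb', Pi.zero_apply, couplingRestrict_apply, if_neg]
    intro h
    obtain ⟨b, -, hb⟩ := Finset.mem_map.1 h
    exact hb' ⟨b, hb⟩

/-- **Covariance of the bond weights under injective site maps**: if `c' ∘ φ = c` on `K` then
`couplingWeight c' (φ K) = couplingWeight c K` (`z₀ ≠ 0`). [cite: Ueltschi1999, §2.3] -/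
theorem couplingWeight_map_inj (hz : atomicPartitionFn β U μ ≠ 0) {c : Bond Λ → ℂ} {c' : Bond Λ' → ℂ}
    {K : Finset (Bond Λ)} (hc : ∀ b ∈ K, c' (bondMapInj φ b) = c b) :
    couplingWeight (Λ := Λ') β U μ c' (K.map (bondMapInj φ)) = couplingWeight β U μ c K := by
  rw [couplingWeight_eq_sum, couplingWeight_eq_sum]
  symm
  refine Finset.sum_bij (fun K' _ => K'.map (bondMapInj φ)) ?_ ?_ ?_ ?_
  · intro K' hK'
    exact Finset.mem_powerset.2 (Finset.map_subset_map.2 (Finset.mem_powerset.1 hK'))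
  · intro K₁ _ K₂ _ h
    exact Finset.map_injective _ h
  · intro K'' hK''
    obtain ⟨u, hu, rfl⟩ := Finset.subset_map_iff.1 (Finset.mem_powerset.1 hK'')
    exact ⟨u, Finset.mem_powerset.2 hu, rfl⟩
  · intro K' hK'
    have hK'K : K' ⊆ K := Finset.mem_powerset.1 hK'
    rw [couplingRestrict_map_inj φ (fun b hb => hc b (hK'K hb)), gibbsRatio_extend_of_injective φ hz,
      ← Finset.map_sdiff, Finset.card_map]

/-- **Covariance of the site activities under injective site maps.** Let `φ : Λ ↪ Λ'` carry the
active bonds `D` into `D'`, suppose every bond of `D'` with both sites in the range of `φ` comes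
from `D`, and `c' ∘ φ = c` on `D`. Then `couplingActivity D' c' (φ A) = couplingActivity D c A` for
every `A ⊆ Λ` (`z₀ ≠ 0`): the weight of a polymer does not depend on the volume, the labelling of
its sites, or the couplings elsewhere. [cite: Ueltschi1999, §2.3 (ρ(𝒜) only involves the sites of 𝒜; periodic weights)] -/
theorem couplingActivity_map_inj (hz : atomicPartitionFn β U μ ≠ 0) {D : Finset (Bond Λ)} {D' : Finset (Bond Λ')}
    (hDD' : D.map (bondMapInj φ) ⊆ D')
    (hD'D : ∀ b' ∈ D', b'.1 ∈ rangeSites φ → b'.2.1 ∈ rangeSites φ → b' ∈ D.map (bondMapInj φ))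
    {c : Bond Λ → ℂ} {c' : Bond Λ' → ℂ} (hc : ∀ b ∈ D, c' (bondMapInj φ b) = c b) (A : Finset Λ) :
    couplingActivity D' β U μ c' (A.map φ) = couplingActivity D β U μ c A := by
  refine pushforwardActivity_connectedCellSets_map (verts := (Bond.verts : Bond Λ → Finset Λ))
    (verts' := (Bond.verts : Bond Λ' → Finset Λ')) (f := bondMapInj φ) (φ := φ) (verts_bondMapInj φ) A hDD'
    (fun X' hX' _ hsupp => ?_) (fun X hX => couplingWeight_map_inj φ hz fun b hb => hc b (hX hb))
  -- every bond of `X'` has both sites in `φ(A) ⊆ range φ`, hence lies in `φ(D)`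
  have himg : X' ⊆ D.map (bondMapInj φ) := fun b' hb' => by
    have h1 : b'.1 ∈ A.map φ := hsupp ▸ (endpoints_mem_cellSupp hb').1
    have h2 : b'.2.1 ∈ A.map φ := hsupp ▸ (endpoints_mem_cellSupp hb').2
    exact hD'D b' (hX' hb') (Finset.map_subset_map.2 (Finset.subset_univ A) h1)
      (Finset.map_subset_map.2 (Finset.subset_univ A) h2)
  obtain ⟨X, hX, rfl⟩ := Finset.subset_map_iff.1 himg
  exact ⟨X, hX, rfl⟩

end Injective

end Literature.MathematicalPhysics.QuantumLattice

end
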